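import Summits.Parity.BatemanHorn.Theorems.SoloInformedWindowEquidistributionRate
import Summits.Parity.BatemanHorn.Theorems.SoloInformedLocatedRootDivergence

/-!
# `Mid_g(x) ≥ c·x·log log x` and `S_g(x) ≥ 2A_g·x log x + c·x·log log x` for `deg g ≥ 3`

[this work]  `SoloInformedLocatedRootDivergence` proved `Mid_g(x)/x → ∞` for irreducible `g` of
degree `≥ 3` (`Mid_g = polyLocatedRootCount`, the open half of Erdős's divisor sum
`S_g(x) = ∑_{n ≤ x} τ(|g(n)|) = 2A_g x log x + 2 Mid_g(x) + O(x)`), from located-root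
equidistribution on BOUNDED windows.  With the GROWING-window theorem
`exists_abs_polyWindowRootCount_sub_heuristic_le_logPow` (windows up to `x (log x)^α`, from Hooley's
bound with an explicit frequency-uniform log-power saving) the divergence gets a RATE:

* `exists_abs_polyWindowRootCount_logWindow_sub_le` — count currency on the growing window: for all
  small `α > 0`, `|W_g(x; x, T_x x) − A_g x log T_x| ≤ K x` with `T_x = ⌊(log x)^α⌋` (`deg g ≥ 2`);
* `exists_sum_card_divisors_small_le_of_pow_le` — the non-located part of such a window is `≤ x`
  (`deg g ≥ 3`, `T⁴ ≤ x`);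
* `exists_eventually_mul_loglog_le_polyLocatedRootCount` — **`Mid_g(x) ≥ c x log log x`**
  eventually, some `c = c(g) > 0` (`deg g ≥ 3`);
* `exists_eventually_loglog_le_polyDivisorSum` — **`S_g(x) ≥ 2A_g x log x + c x log log x`**
  eventually (`deg g ≥ 3`): an unconditional secondary term of the right sign in Erdős's problem
  (conjecturally `Mid_g(x) ∼ ((d−2)/2)·A_g·x log x`, i.e. `S_g(x) ∼ d·A_g·x log x`; the
  located-root problem at power scales `x (log x)^α < e < x^{d/2}` stays open).
-/

noncomputable section

open Finset Polynomial Filter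

namespace Summit.Parity.BatemanHorn.Theorems

/-! ### Count currency on the growing window -/

/-- **The growing window in count currency.** [this work]  For `g` irreducible of degree `≥ 2`
there are `K` and `α₀ > 0` such that for every `0 < α ≤ α₀` and all large `x`, with
`T_x = ⌊(log x)^α⌋`:  `|W_g(x; x, T_x·x) − A_g·x·log T_x| ≤ K·x`  (`A_g = rootLevelConst g`). -/
theorem exists_abs_polyWindowRootCount_logWindow_sub_le {g : ℤ[X]} (hirr : Irreducible g)
    (hdeg : 2 ≤ g.natDegree) :
    ∃ K : ℝ, ∃ α₀ : ℝ, 0 < α₀ ∧ ∀ α : ℝ, 0 < α → α ≤ α₀ → ∃ x₀ : ℕ, ∀ x : ℕ, x₀ ≤ x →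
      |(polyWindowRootCount g x x (⌊Real.log x ^ α⌋₊ * x) : ℝ)
          - rootLevelConst g * x * Real.log (⌊Real.log x ^ α⌋₊ : ℕ)| ≤ K * x := by
  obtain ⟨K₀, hK₀⟩ := exists_abs_polySmallLevel_sub_log_le hirr (by omega)
  obtain ⟨α₀, hα₀, hB⟩ := exists_abs_polyWindowRootCount_sub_heuristic_le_logPow hirr hdeg
  refine ⟨2 * K₀ + 1, α₀, hα₀, fun α hα hαα₀ => ?_⟩
  obtain ⟨x₀, hx₀⟩ := hB 1 one_pos
  have hL : Tendsto (fun x : ℕ => Real.log (x : ℝ)) atTop atTop :=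
    Real.tendsto_log_atTop.comp tendsto_natCast_atTop_atTop
  obtain ⟨x₁, hx₁⟩ := eventually_atTop.1 ((hL.eventually_ge_atTop 1).and (eventually_ge_atTop x₀))
  refine ⟨max x₁ 1, fun x hx => ?_⟩
  obtain ⟨hL1, hx₀x⟩ := hx₁ x (le_trans (le_max_left _ _) hx)
  have hx1 : 1 ≤ x := le_trans (le_max_right _ _) hx
  set L : ℝ := Real.log (x : ℝ) with hLdef
  have hLα1 : 1 ≤ L ^ α := Real.one_le_rpow hL1 hα.le
  have hLαle : L ^ α ≤ L ^ α₀ := Real.rpow_le_rpow_of_exponent_le hL1 hαα₀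
  set T : ℕ := ⌊L ^ α⌋₊ with hTdef
  have hT1 : 1 ≤ T := Nat.le_floor (by exact_mod_cast hLα1)
  have hT0 : 0 < T := hT1
  have hxT : x ≤ T * x := Nat.le_mul_of_pos_left x hT0
  have hTx1 : 1 ≤ T * x := le_trans hx1 hxT
  have hxr : (0 : ℝ) ≤ x := Nat.cast_nonneg _
  have hyL : ((T * x : ℕ) : ℝ) ≤ Real.log x ^ α₀ * x := by
    push_cast
    refine mul_le_mul_of_nonneg_right ?_ hxr
    exact (Nat.floor_le (by positivity)).trans hLαle
  have hw := hx₀ x (T * x) hx₀x hxT hyL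
  rw [polyWindowHeuristic_eq_mul_sub g x hxT, one_mul] at hw
  have ha := hK₀ (T * x) hTx1
  have hb := hK₀ x hx1
  have hlog : Real.log ((T * x : ℕ) : ℝ) = Real.log T + Real.log x := by
    push_cast
    exact Real.log_mul (by exact_mod_cast hT0.ne') (by exact_mod_cast (by omega : x ≠ 0))
  rw [hlog] at ha
  have key : (polyWindowRootCount g x x (T * x) : ℝ) - rootLevelConst g * x * Real.log T
      = ((polyWindowRootCount g x x (T * x) : ℝ)
          - x * (polySmallLevel g (T * x) - polySmallLevel g x))
        + x * (polySmallLevel g (T * x) - rootLevelConst g * (Real.log T + Real.log x))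
        - x * (polySmallLevel g x - rootLevelConst g * Real.log x) := by ring
  rw [key]
  obtain ⟨ha1, ha2⟩ := abs_le.1 ha
  obtain ⟨hb1, hb2⟩ := abs_le.1 hb
  obtain ⟨hw1, hw2⟩ := abs_le.1 hw
  have e1 := mul_le_mul_of_nonneg_left ha1 hxr
  have e2 := mul_le_mul_of_nonneg_left ha2 hxr
  have e3 := mul_le_mul_of_nonneg_left hb1 hxr
  have e4 := mul_le_mul_of_nonneg_left hb2 hxr
  rw [abs_le]
  constructor <;> linarith

/-! ### The non-located part of a window with `T⁴ ≤ x` -/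

/-- **Small values, uniformly in the window** (`deg g ≥ 3`): for `x ≥ x₁(g)` and every `T` with
`T⁴ ≤ x`, `∑_{n ≤ x, |g(n)| ≤ (Tx)²} τ(|g(n)|) ≤ x`.  (The `n` with `|g(n)| ≤ Y ≤ x^{5/2}` number
`≤ e^{B/3} x^{5/6}` by `card_filter_natAbs_eval_le_exp`, each with `τ(|g(n)|) ≤ C_F x^{1/96}`.)
[this work] -/
theorem exists_sum_card_divisors_small_le_of_pow_le {g : ℤ[X]} (hirr : Irreducible g)
    (hdeg : 3 ≤ g.natDegree) :
    ∃ x₁ : ℕ, ∀ x T : ℕ, x₁ ≤ x → T ^ 4 ≤ x →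
      (∑ n ∈ (Icc 1 x).filter (fun n : ℕ => (g.eval (n : ℤ)).natAbs ≤ T * x * (T * x)),
          (#((g.eval (n : ℤ)).natAbs.divisors) : ℝ)) ≤ x := by
  obtain ⟨B, hB⟩ := exists_abs_log_natAbs_eval_sub_le (g := g) (by omega)
  obtain ⟨CF, hCF0, hCF⟩ := ErdosDivisor.exists_card_divisors_eval_le (g := g) (by omega)
  have hz : ∀ n : ℕ, 1 ≤ n → g.eval (n : ℤ) ≠ 0 :=
    fun n _ => eval_natCast_ne_zero_of_irreducible hirr (by omega) n
  set CF' : ℝ := max CF 1 with hCF'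
  have hCF'pos : 0 < CF' := lt_of_lt_of_le one_pos (le_max_right _ _)
  set Q : ℝ := 32 / 5 * (B / 3 + Real.log CF') with hQ
  refine ⟨max 1 ⌈Real.exp Q⌉₊, fun x T hx hT4 => ?_⟩
  have hx1 : 1 ≤ x := le_of_max_le_left hx
  have hxQ : ⌈Real.exp Q⌉₊ ≤ x := le_of_max_le_right hx
  have hxpos : (0 : ℝ) < x := by exact_mod_cast hx1
  have hlogx0 : 0 ≤ Real.log (x : ℝ) := Real.log_nonneg (by exact_mod_cast hx1)
  have hlogx : Q ≤ Real.log x := by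
    have h1 : Real.exp Q ≤ (x : ℝ) := (Nat.le_ceil _).trans (by exact_mod_cast hxQ)
    have := Real.log_le_log (Real.exp_pos Q) h1
    rwa [Real.log_exp] at this
  -- the set of small values and `log Y ≤ (5/2) log x`
  set Y : ℕ := T * x * (T * x) with hYdef
  set F := (Icc 1 x).filter (fun n : ℕ => (g.eval (n : ℤ)).natAbs ≤ Y) with hF
  have hlogY : Real.log (Y : ℝ) ≤ 5 / 2 * Real.log x := by
    rcases Nat.eq_zero_or_pos T with hT0 | hT0
    · have hY0 : Y = 0 := by rw [hYdef, hT0]; ring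
      rw [hY0, Nat.cast_zero, Real.log_zero]
      linarith
    · have hYpos : (0 : ℝ) < Y := by
        rw [hYdef]; exact_mod_cast Nat.mul_pos (Nat.mul_pos hT0 hx1) (Nat.mul_pos hT0 hx1)
      have hY2 : ((Y : ℝ)) ^ 2 ≤ (x : ℝ) ^ 5 := by
        have h : Y ^ 2 ≤ x ^ 5 := by
          calc Y ^ 2 = T ^ 4 * x ^ 4 := by rw [hYdef]; ring
            _ ≤ x * x ^ 4 := Nat.mul_le_mul_right _ hT4
            _ = x ^ 5 := by ring
        exact_mod_cast h
      have h2 := Real.log_le_log (pow_pos hYpos 2) hY2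
      rw [Real.log_pow, Real.log_pow] at h2
      push_cast at h2
      linarith
  have hcount : (#F : ℝ) ≤ Real.exp ((5 / 2 * Real.log x + B) / 3) :=
    (card_filter_natAbs_eval_le_exp hdeg hB hz x Y).trans
      (Real.exp_le_exp.2 (by linarith))
  have hx96 : (x : ℝ) ^ (1 / 96 : ℝ) = Real.exp (Real.log x * (1 / 96)) :=
    Real.rpow_def_of_pos hxpos _
  have hprod : Real.exp ((5 / 2 * Real.log x + B) / 3) * (CF' * (x : ℝ) ^ (1 / 96 : ℝ))
      = Real.exp ((5 / 2 * Real.log x + B) / 3 + Real.log CF' + Real.log x * (1 / 96)) := by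
    rw [Real.exp_add, Real.exp_add, Real.exp_log hCF'pos, ← hx96]; ring
  have hexp : (5 / 2 * Real.log x + B) / 3 + Real.log CF' + Real.log x * (1 / 96)
      ≤ Real.log x := by
    rw [hQ] at hlogx
    linarith
  calc (∑ n ∈ F, (#((g.eval (n : ℤ)).natAbs.divisors) : ℝ))
      ≤ ∑ n ∈ F, CF * (x : ℝ) ^ (1 / 96 : ℝ) :=
        sum_le_sum fun n hn => hCF x hx1 n ((filter_subset _ _) hn)
    _ = #F * (CF * (x : ℝ) ^ (1 / 96 : ℝ)) := by rw [sum_const, nsmul_eq_mul]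
    _ ≤ Real.exp ((5 / 2 * Real.log x + B) / 3) * (CF' * (x : ℝ) ^ (1 / 96 : ℝ)) :=
        mul_le_mul hcount (mul_le_mul_of_nonneg_right (le_max_left _ _) (by positivity))
          (by positivity) (Real.exp_pos _).le
    _ = Real.exp ((5 / 2 * Real.log x + B) / 3 + Real.log CF' + Real.log x * (1 / 96)) := hprod
    _ ≤ Real.exp (Real.log x) := Real.exp_le_exp.2 hexp
    _ = x := Real.exp_log hxpos

/-! ### The `log log` lower bounds -/

/-- **`Mid_g(x) ≥ c·x·log log x`** (unconditional): for every irreducible `g ∈ ℤ[X]` of degree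
`≥ 3` there is `c > 0` with `c·x·log log x ≤ Mid_g(x)` for all large `x`.
(Growing window `T_x = ⌊(log x)^α⌋`, `α ≤ 1/4`: `W_g(x; x, T_x x) ≥ A_g x log T_x − Kx`,
`log T_x ≥ α log log x − log 2`, and the non-located part of the window is `≤ x`.)
[this work; input: Hooley, Acta Math. 111 (1964), with the log-power saving made frequency-uniform] -/
theorem exists_eventually_mul_loglog_le_polyLocatedRootCount {g : ℤ[X]} (hirr : Irreducible g)
    (hdeg : 3 ≤ g.natDegree) :
    ∃ c : ℝ, 0 < c ∧ ∀ᶠ x : ℕ in atTop,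
      c * x * Real.log (Real.log x) ≤ (polyLocatedRootCount g x : ℝ) := by
  obtain ⟨K, α₀, hα₀, hW⟩ :=
    exists_abs_polyWindowRootCount_logWindow_sub_le hirr (by omega : 2 ≤ g.natDegree)
  have hA := rootLevelConst_pos hirr (by omega : 0 < g.natDegree)
  set A : ℝ := rootLevelConst g with hAdef
  set α : ℝ := min α₀ (1 / 4) with hαdef
  have hα : 0 < α := lt_min hα₀ (by norm_num)
  have hαα₀ : α ≤ α₀ := min_le_left _ _
  have hα4 : α ≤ 1 / 4 := min_le_right _ _
  obtain ⟨x₀, hx₀⟩ := hW α hα hαα₀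
  obtain ⟨x₁, hx₁⟩ := exists_sum_card_divisors_small_le_of_pow_le hirr hdeg
  set c : ℝ := α * A / 2 with hcdef
  have hc : 0 < c := by positivity
  refine ⟨c, hc, ?_⟩
  have hL : Tendsto (fun x : ℕ => Real.log (x : ℝ)) atTop atTop :=
    Real.tendsto_log_atTop.comp tendsto_natCast_atTop_atTop
  have hLL : Tendsto (fun x : ℕ => Real.log (Real.log (x : ℝ))) atTop atTop :=
    Real.tendsto_log_atTop.comp hL
  have hev1 : ∀ᶠ x : ℕ in atTop, (1 : ℝ) ≤ Real.log x := hL.eventually_ge_atTop 1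
  have hev2 : ∀ᶠ x : ℕ in atTop, (2 : ℝ) ≤ Real.log x ^ α :=
    ((tendsto_rpow_atTop hα).comp hL).eventually_ge_atTop 2
  have hev3 : ∀ᶠ x : ℕ in atTop, (A * Real.log 2 + K + 1) / c ≤ Real.log (Real.log (x : ℝ)) :=
    hLL.eventually_ge_atTop _
  filter_upwards [hev1, hev2, hev3, eventually_ge_atTop x₀, eventually_ge_atTop x₁,
    eventually_ge_atTop 1] with x h1 h2 h3 hxx₀ hxx₁ hx1
  have hw := (abs_le.1 (hx₀ x hxx₀)).1
  set L : ℝ := Real.log (x : ℝ) with hLdef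
  have hL0 : 0 < L := by linarith
  have hxpos : (0 : ℝ) < x := by exact_mod_cast hx1
  set T : ℕ := ⌊L ^ α⌋₊ with hTdef
  -- `T ≥ L^α / 2 ≥ 1` and `log T ≥ α log L − log 2`
  have hTge : L ^ α / 2 ≤ T := by
    have := Nat.lt_floor_add_one (L ^ α)
    rw [hTdef]
    linarith
  have hTle : (T : ℝ) ≤ L ^ α := Nat.floor_le (by positivity)
  have hTpos : (0 : ℝ) < T := by linarith
  have hlogT : α * Real.log L - Real.log 2 ≤ Real.log T := by
    have h := Real.log_le_log (by positivity) hTge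
    rwa [Real.log_div (by positivity) two_ne_zero, Real.log_rpow hL0] at h
  -- `T⁴ ≤ x`
  have hT4 : T ^ 4 ≤ x := by
    have hT4r : (T : ℝ) ^ 4 ≤ L := by
      have hL4 : L ^ α ≤ L ^ (1 / 4 : ℝ) := Real.rpow_le_rpow_of_exponent_le h1 hα4
      calc (T : ℝ) ^ 4 ≤ (L ^ (1 / 4 : ℝ)) ^ 4 := pow_le_pow_left₀ hTpos.le (hTle.trans hL4) 4
        _ = L := by
          rw [← Real.rpow_natCast, ← Real.rpow_mul hL0.le]
          norm_num
    have hLx : L ≤ x := Real.log_le_self hxpos.le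
    exact_mod_cast hT4r.trans hLx
  -- the remaining inputs
  have hsmall := hx₁ x T hxx₁ hT4
  have hsplit : (polyWindowRootCount g x x (T * x) : ℝ)
      ≤ polyLocatedRootCount g x
        + ∑ n ∈ (Icc 1 x).filter (fun n : ℕ => (g.eval (n : ℤ)).natAbs ≤ T * x * (T * x)),
            (#((g.eval (n : ℤ)).natAbs.divisors) : ℝ) := by
    exact_mod_cast polyWindowRootCount_le_located_add g x (T * x)
  -- assemble
  have hAx : 0 ≤ A * x := by positivity
  have e1 : A * x * (α * Real.log L - Real.log 2) ≤ A * x * Real.log T :=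
    mul_le_mul_of_nonneg_left hlogT hAx
  have e2 : A * Real.log 2 + K + 1 ≤ c * Real.log L := by
    have := (div_le_iff₀ hc).1 h3
    linarith
  have e3 : (A * Real.log 2 + K + 1) * x ≤ c * Real.log L * x :=
    mul_le_mul_of_nonneg_right e2 hxpos.le
  have e4 : A * x * (α * Real.log L) = 2 * (c * x * Real.log L) := by rw [hcdef]; ring
  linarith [hw, hsmall, hsplit, e1, e3, e4]

/-- **An unconditional secondary term in Erdős's divisor problem** (`deg g ≥ 3`): there is
`c = c(g) > 0` with `2·A_g·x log x + c·x·log log x ≤ S_g(x) = ∑_{n ≤ x} τ(|g(n)|)` for all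
large `x`.  From `S_g = 2A_g x log x + 2 Mid_g + O(x)` and
`exists_eventually_mul_loglog_le_polyLocatedRootCount`. [this work] -/
theorem exists_eventually_loglog_le_polyDivisorSum {g : ℤ[X]} (hirr : Irreducible g)
    (hdeg : 3 ≤ g.natDegree) :
    ∃ c : ℝ, 0 < c ∧ ∀ᶠ x : ℕ in atTop,
      2 * rootLevelConst g * (x : ℝ) * Real.log x + c * x * Real.log (Real.log x)
        ≤ (polyDivisorSum g x : ℝ) := by
  obtain ⟨C, hC⟩ := exists_abs_polyDivisorSum_sub_located_sub_log_le_of_two_le hirr (by omega)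
  obtain ⟨c, hc, hMid⟩ := exists_eventually_mul_loglog_le_polyLocatedRootCount hirr hdeg
  refine ⟨c, hc, ?_⟩
  have hLL : Tendsto (fun x : ℕ => Real.log (Real.log (x : ℝ))) atTop atTop :=
    Real.tendsto_log_atTop.comp (Real.tendsto_log_atTop.comp tendsto_natCast_atTop_atTop)
  filter_upwards [hMid, hLL.eventually_ge_atTop (C / c), eventually_ge_atTop 2] with x hx hCc hx2
  have hxpos : (0 : ℝ) < x := by exact_mod_cast (show 0 < x by omega)
  have h1 := (abs_le.1 (hC x hx2)).1
  have h2 : C ≤ c * Real.log (Real.log (x : ℝ)) := by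
    have := (div_le_iff₀ hc).1 hCc
    linarith
  have h3 : C * x ≤ c * Real.log (Real.log (x : ℝ)) * x := mul_le_mul_of_nonneg_right h2 hxpos.le
  linarith

end Summit.Parity.BatemanHorn.Theorems

end
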